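import Literature.Geometry.Riemannian.MCFComparisonPrinciple
import Literature.Geometry.Riemannian.WeakSetFlowTimeShift
import HarnessLib

/-!
# The level set flow of a round ball: shrinking balls are weak set flows; arrival time and
# extinction time

Topic `Literature/Geometry/Riemannian`. The first exact computation of the tree's level set flow
(`Literature.Geometry.Riemannian.levelSetFlow`, Hershkovits–White's biggest weak set flow,
`MeanConvexLevelSetFlow.lean`): for `n ≥ 1` and the closed ball `B̄(c, r₀) ⊆ ℝⁿ⁺¹`,

  `F_t(B̄(c, r₀)) = B̄(c, √(r₀² - 2nt))` for `0 ≤ t ≤ T = r₀²/(2n)`, `= ∅` for `t > T`,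

so that the arrival time is `u(x) = (r₀² - ‖x - c‖²)/(2n)` and the extinction time is Huisken's
`T = r₀²/(2n)` (Evans–Spruck 1991, §7.1, (7.2)–(7.3): the generalized evolution of the round
sphere is the shrinking sphere until `t* = R²/(2(n-1))` in their dimension convention, `{0}` at
`t*`, `∅` after). The inclusion `⊆` is the outer sphere barrier of `LevelSetFlowExtinction.lean`;
the inclusion `⊇` needs a weak set flow realising the shrinking ball, i.e. that classical test
flows AVOID the shrinking balls — this is the comparison principle of
`MCFComparisonPrinciple.lean` against the classical sphere flow (`ShrinkingSphereMCF.lean`) plus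
an intermediate value argument (a flow cannot enter the ball without touching the sphere).
Everything is PROVED; no definitions, no named facts.

## Contents

* `continuous_shrinkingSphereRadius`, `shrinkingSphereRadius_eq_sqrt` — `R(t) = √(2n(T - t))`,
  `= √(r₀² - 2nt)` for `T = r₀²/(2n)`.
* `IsClassicalMCF.continuousOn_slice`; `IsClassicalMCF.shrinkingSphereRadius_add_le_norm_sub` —
  **margin form of the comparison with the shrinking sphere**: a classical flow at distance
  `≥ R(a') + δ` from `c` at time `a'` stays at distance `≥ R(t) + δ` for `t ≤ T`.
* `isWeakSetFlowIn_shrinkingBall` — **the shrinking closed balls form a weak set flow** on `[0, ∞)`.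
* `closedBall_subset_levelSetFlow_closedBall`, `levelSetFlow_closedBall_subset`,
  `levelSetFlow_closedBall` (**`F_t(B̄(c, r₀)) = B̄(c, √(r₀² - 2nt))`**),
  `levelSetFlow_closedBall_eq_empty` (`= ∅` past `T`), `mem_levelSetFlow_closedBall_iff`.
* `arrivalTime_closedBall` (**`u(x) = (r₀² - ‖x - c‖²)/(2n)`**), `extinctionTime_closedBall`
  (**`= r₀²/(2n)`**).
* (appended, `section Lifespan`) `IsClassicalMCF.range_subset_levelSetFlow_closedBall`,
  `IsClassicalMCF.two_mul_mul_sub_le_sq_of_mem`, `IsClassicalMCF.two_mul_mul_sub_le_sq`,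
  `IsClassicalMCF.range_subset_closedBall_sqrt` — **a classical flow whose initial slice lies in
  `B̄(c, r₀)` lives inside the shrinking balls `B̄(c, √(r₀² - 2n(t-a)))` and cannot be defined past
  `a + r₀²/(2n)`** (lifespan bound by comparison with the shrinking sphere).

## References

* L. C. Evans, J. Spruck, *Motion of level sets by mean curvature. I*, J. Differential Geom. 33
  (1991), §7.1, (7.2)–(7.3) and Thm. 7.1. [EvansSpruck1991]
* G. Huisken, *Flow by mean curvature of convex surfaces into spheres*, J. Differential Geom. 20
  (1984), §1. [Huisken1984]
* B. White, J. Amer. Math. Soc. 13 (2000), §2; O. Hershkovits, B. White, Comm. Pure Appl. Math.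
  73 (2020), Appendix, Def. 19. [White2000] [HershkovitsWhite2019]
* C. Mantegazza, *Lecture Notes on Mean Curvature Flow* (2011), Thm. 2.2.1. [Mantegazza2011]
* T. H. Colding, W. P. Minicozzi II, *Differentiability of the arrival time*, Comm. Pure Appl.
  Math. 69 (2016), §1. [ColdingMinicozzi2016]
-/

noncomputable section

open Bundle Set Function Metric Module Filter
open scoped Manifold ContDiff Topology RealInnerProductSpace ENNReal

namespace Literature.Geometry.Riemannian

open Lorentzian Lorentzian.PseudoRiemannianMetric

variable {n : ℕ}

/-! ### The radius function -/

section Radius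

/-- `t ↦ R(t) = √(2n(T - t))` is continuous. [folklore] -/
theorem continuous_shrinkingSphereRadius (n : ℕ) (T : ℝ) :
    Continuous (shrinkingSphereRadius n T) := by
  unfold shrinkingSphereRadius
  fun_prop

/-- `R(t) ≥ 0`. [folklore] -/
theorem shrinkingSphereRadius_nonneg (n : ℕ) (T t : ℝ) : 0 ≤ shrinkingSphereRadius n T t :=
  Real.sqrt_nonneg _

/-- In terms of the initial radius: with `T = r₀²/(2n)`, `R(t) = √(r₀² - 2nt)` (`n ≥ 1`).
[cite: Huisken1984, §1] -/
theorem shrinkingSphereRadius_eq_sqrt (hn : 1 ≤ n) (r₀ t : ℝ) :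
    shrinkingSphereRadius n (r₀ ^ 2 / (2 * n)) t = Real.sqrt (r₀ ^ 2 - 2 * n * t) := by
  have hn0 : (0 : ℝ) < n := by exact_mod_cast hn
  unfold shrinkingSphereRadius
  congr 1
  field_simp

end Radius

/-! ### A classical flow starting outside a ball stays outside the shrinking ball -/

section Outside

variable {N' : Type*} [TopologicalSpace N'] [ChartedSpace (EuclideanSpace ℝ (Fin n)) N']
  [IsManifold (𝓡 n) ∞ N'] {F' : ℝ → N' → EuclideanSpace ℝ (Fin (n + 1))}
  {ν' : (t : ℝ) → NormalField (𝓡 (n + 1)) (F' t)} {a' b' : ℝ}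

/-- Time slices of a classical flow depend continuously on time: `s ↦ F(s, y)` is continuous on
`[a, b]`. [folklore] -/
theorem IsClassicalMCF.continuousOn_slice
    (hF' : IsClassicalMCF (euclideanMetric (EuclideanSpace ℝ (Fin (n + 1)))) F' ν' a' b') (y : N') :
    ContinuousOn (fun s ↦ F' s y) (Icc a' b') := by
  obtain ⟨U, hU, hIU, hF⟩ := hF'.contMDiffOn
  exact fun s hs ↦ (contDiffAt_slice hU hF (hIU hs) y).continuousAt.continuousWithinAt

/-- **Comparison with the shrinking sphere, margin form.** If a classical flow `F'` on `[a', b']`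
starts at distance `≥ R(a') + δ` (`δ > 0`) from the centre `c`, where `R(t) = √(2n(T - t))` is the
radius of the round spheres about `c` extinct at time `T`, then `‖F'(t, y) - c‖ ≥ R(t) + δ` for
all `t ∈ [a', b']` with `t ≤ T`. For `t < T` this is the comparison principle
`IsClassicalMCF.le_norm_sub` against the classical sphere flow `isClassicalMCF_shrinkingSphereAt`
on `[a', t]`, combined with the intermediate value theorem (the flow cannot enter the ball without
first touching the sphere); `t = T` follows by continuity. Evans–Spruck 1991, §7.1 (comparison
with the shrinking sphere (7.2)); White 2000, §2. [cite: EvansSpruck1991, §7.1]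
[cite: Mantegazza2011, Thm. 2.2.1] -/
theorem IsClassicalMCF.shrinkingSphereRadius_add_le_norm_sub (hn : 1 ≤ n)
    (hF' : IsClassicalMCF (euclideanMetric (EuclideanSpace ℝ (Fin (n + 1)))) F' ν' a' b')
    (c : EuclideanSpace ℝ (Fin (n + 1))) {T δ : ℝ} (hδ : 0 < δ)
    (hinit : ∀ y, shrinkingSphereRadius n T a' + δ ≤ ‖F' a' y - c‖)
    {t : ℝ} (ht : t ∈ Icc a' b') (htT : t ≤ T) (y : N') :
    shrinkingSphereRadius n T t + δ ≤ ‖F' t y - c‖ := by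
  -- Step A: comparison with the sphere flow on `[a', s]`, `s < T`
  have stepA : ∀ s ∈ Icc a' b', s < T → ∀ (y : N')
      (z : sphere (0 : EuclideanSpace ℝ (Fin (n + 1))) 1),
      δ ≤ ‖F' s y - (c + shrinkingSphereRadius n T s • (z : EuclideanSpace ℝ (Fin (n + 1))))‖ := by
    intro s hs hsT y z
    have h1 : IsClassicalMCF _ F' ν' a' s := hF'.mono (Icc_subset_Icc le_rfl hs.2)
    have h2 := isClassicalMCF_shrinkingSphereAt hn c T (a := a') hsT
    refine h1.le_norm_sub h2 (fun y' z' ↦ ?_) (right_mem_Icc.2 hs.1) y z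
    have hz' : ‖(z' : EuclideanSpace ℝ (Fin (n + 1)))‖ = 1 := by simp
    calc δ ≤ ‖F' a' y' - c‖ - shrinkingSphereRadius n T a' := by linarith [hinit y']
      _ = ‖F' a' y' - c‖ - ‖shrinkingSphereRadius n T a' • (z' : EuclideanSpace ℝ (Fin (n + 1)))‖ := by
          rw [norm_smul, hz', mul_one, Real.norm_of_nonneg (shrinkingSphereRadius_nonneg n T a')]
      _ ≤ ‖F' a' y' - c - shrinkingSphereRadius n T a' • (z' : EuclideanSpace ℝ (Fin (n + 1)))‖ :=
          norm_sub_norm_le _ _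
      _ = ‖F' a' y' - shrinkingSphereFlowAt n c T a' z'‖ := by
          rw [shrinkingSphereFlowAt_apply, sub_sub]
  -- Step B: outside or on the sphere but within `δ` of it is impossible
  have stepB : ∀ s ∈ Icc a' b', s < T → ∀ y : N',
      shrinkingSphereRadius n T s ≤ ‖F' s y - c‖ → shrinkingSphereRadius n T s + δ ≤ ‖F' s y - c‖ := by
    intro s hs hsT y hout
    by_contra hlt
    rw [not_le] at hlt
    have hR := shrinkingSphereRadius_pos hn hsT
    set v : EuclideanSpace ℝ (Fin (n + 1)) := F' s y - c with hv
    have hv0 : 0 < ‖v‖ := hR.trans_le hout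
    have hvne : v ≠ 0 := norm_pos_iff.1 hv0
    -- the nearest point of the sphere
    have hzmem : ‖v‖⁻¹ • v ∈ sphere (0 : EuclideanSpace ℝ (Fin (n + 1))) 1 := by
      rw [mem_sphere_zero_iff_norm, norm_smul, norm_inv, norm_norm, inv_mul_cancel₀ hv0.ne']
    have key := stepA s hs hsT y ⟨_, hzmem⟩
    have hcalc : F' s y - (c + shrinkingSphereRadius n T s • (‖v‖⁻¹ • v)) =
        (1 - shrinkingSphereRadius n T s * ‖v‖⁻¹) • v := by
      rw [sub_smul, one_smul, mul_smul, ← sub_sub, ← hv]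
    have hcoef : 0 ≤ 1 - shrinkingSphereRadius n T s * ‖v‖⁻¹ := by
      rw [sub_nonneg, ← div_eq_mul_inv, div_le_one hv0]
      exact hout
    have hnorm : ‖F' s y - (c + shrinkingSphereRadius n T s • (‖v‖⁻¹ • v))‖ =
        ‖v‖ - shrinkingSphereRadius n T s := by
      rw [hcalc, norm_smul, Real.norm_of_nonneg hcoef, sub_mul, one_mul, mul_assoc,
        inv_mul_cancel₀ hv0.ne', mul_one]
    rw [hnorm] at key
    linarith
  -- Step C: the flow cannot be inside the sphere either (intermediate value theorem)
  have stepC : ∀ s ∈ Icc a' b', s < T → ∀ y : N',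
      shrinkingSphereRadius n T s + δ ≤ ‖F' s y - c‖ := by
    intro s hs hsT y
    rcases le_or_gt (shrinkingSphereRadius n T s) ‖F' s y - c‖ with hout | hin
    · exact stepB s hs hsT y hout
    · exfalso
      -- `g(r) = ‖F' r y - c‖ - R(r)` is continuous on `[a', s]`, `≥ δ > 0` at `a'`, `< 0` at `s`
      have hg : ContinuousOn (fun r ↦ ‖F' r y - c‖ - shrinkingSphereRadius n T r) (Icc a' s) :=
        (((hF'.continuousOn_slice y).mono (Icc_subset_Icc le_rfl hs.2)).sub
          continuousOn_const).norm.sub (continuous_shrinkingSphereRadius n T).continuousOn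
      have h0 : (0 : ℝ) ∈ Icc (‖F' s y - c‖ - shrinkingSphereRadius n T s)
          (‖F' a' y - c‖ - shrinkingSphereRadius n T a') :=
        ⟨by linarith, by linarith [hinit y]⟩
      obtain ⟨s₁, hs₁, hgs₁⟩ := intermediate_value_Icc' hs.1 hg h0
      have hs₁' : s₁ ∈ Icc a' b' := ⟨hs₁.1, hs₁.2.trans hs.2⟩
      have h1 := stepB s₁ hs₁' (lt_of_le_of_lt hs₁.2 hsT) y (by simp only at hgs₁; linarith)
      simp only at hgs₁
      linarith
  -- Step D: `t < T` is Step C; `t = T` by continuity from the left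
  rcases lt_or_eq_of_le htT with htT' | rfl
  · exact stepC t ht htT' y
  · rcases eq_or_lt_of_le ht.1 with rfl | hat
    · exact hinit y
    · -- limit along `s → T⁻` of `R(s) + δ ≤ ‖F' s y - c‖`
      have hcont : ContinuousWithinAt (fun s ↦ ‖F' s y - c‖ - shrinkingSphereRadius n t s)
          (Ico a' t) t :=
        ((((hF'.continuousOn_slice y).mono (Icc_subset_Icc le_rfl ht.2)).sub
          continuousOn_const).norm.sub (continuous_shrinkingSphereRadius n t).continuousOn
          |>.continuousWithinAt (right_mem_Icc.2 ht.1)).mono Ico_subset_Icc_self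
      haveI : (𝓝[Ico a' t] t).NeBot := right_nhdsWithin_Ico_neBot hat
      have hev : ∀ᶠ s in 𝓝[Ico a' t] t, δ ≤ ‖F' s y - c‖ - shrinkingSphereRadius n t s := by
        filter_upwards [self_mem_nhdsWithin] with s hs
        have := stepC s ⟨hs.1, hs.2.le.trans ht.2⟩ hs.2 y
        linarith
      have hle := ge_of_tendsto hcont.tendsto hev
      linarith

end Outside

/-! ### The shrinking closed ball is a weak set flow -/

section Ball

/-- **The shrinking closed balls `B̄(c, √(2n(T - t)))`, `t ≤ T` (and `∅` for `t > T`), form a weak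
set flow** in `ℝⁿ⁺¹` on `[0, ∞)` (`n ≥ 1`): the track `{(x, t) : t ≤ T, ‖x - c‖ ≤ R(t)}` is closed,
and a classical flow disjoint from `B̄(c, R(a'))` at time `a'` has a positive margin `δ` by
compactness and keeps it (`shrinkingSphereRadius_add_le_norm_sub`). This is the weak-set-flow form
of Evans–Spruck's example (1991, §7.1, (7.2): the generalized evolution of the round sphere /
ball is the shrinking sphere / ball, extinct at `T`, with `{c}` left at `t = T`).
[cite: EvansSpruck1991, §7.1 (7.2)–(7.3)] [cite: HershkovitsWhite2019, Appendix Def. 19] -/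
theorem isWeakSetFlowIn_shrinkingBall (hn : 1 ≤ n) (c : EuclideanSpace ℝ (Fin (n + 1))) (T : ℝ) :
    IsWeakSetFlowIn (euclideanMetric (EuclideanSpace ℝ (Fin (n + 1)))) univ (Ici 0)
      fun t ↦ {x | t ≤ T ∧ x ∈ closedBall c (shrinkingSphereRadius n T t)} := by
  refine ⟨fun t _ ↦ subset_univ _, ⟨{p | p.2 ≤ T ∧ ‖p.1 - c‖ ≤ shrinkingSphereRadius n T p.2},
    ?_, ?_⟩, ?_⟩
  · exact (isClosed_le continuous_snd continuous_const).inter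
      (isClosed_le (continuous_fst.sub continuous_const).norm
        ((continuous_shrinkingSphereRadius n T).comp continuous_snd))
  · ext ⟨x, t⟩
    simp only [mem_setOf_eq, mem_Ici, mem_closedBall, dist_eq_norm, mem_inter_iff, mem_prod,
      mem_univ, true_and]
    tauto
  · intro a' b' hab' hI' N' _ _ _ F' ν' hF' _ hdis t ht
    change Disjoint (range (F' t)) {x | t ≤ T ∧ x ∈ closedBall c (shrinkingSphereRadius n T t)}
    change Disjoint (range (F' a'))
      {x | a' ≤ T ∧ x ∈ closedBall c (shrinkingSphereRadius n T a')} at hdis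
    by_cases htT : t ≤ T
    swap
    · have : {x : EuclideanSpace ℝ (Fin (n + 1)) |
          t ≤ T ∧ x ∈ closedBall c (shrinkingSphereRadius n T t)} = ∅ := by
        ext x; simp [htT]
      rw [this]
      exact disjoint_empty _
    have haT : a' ≤ T := ht.1.trans htT
    refine Set.disjoint_left.2 fun x hx₁ hx₂ ↦ ?_
    obtain ⟨y, rfl⟩ := hx₁
    haveI := hF'.compactSpace
    haveI : Nonempty N' := ⟨y⟩
    -- the initial margin
    have hout : ∀ y', shrinkingSphereRadius n T a' < ‖F' a' y' - c‖ := fun y' ↦ by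
      by_contra hle
      rw [not_lt] at hle
      exact Set.disjoint_left.1 hdis (mem_range_self y') ⟨haT, mem_closedBall_iff_norm.2 hle⟩
    have ha' : a' ∈ Icc a' b' := left_mem_Icc.2 hab'
    have hcont : Continuous fun y' ↦ ‖F' a' y' - c‖ :=
      ((hF'.isSpacelikeImmersion a' ha').contMDiff_self.continuous.sub continuous_const).norm
    obtain ⟨y₀, -, hy₀⟩ := isCompact_univ.exists_isMinOn univ_nonempty hcont.continuousOn
    have hmin := isMinOn_univ_iff.1 hy₀
    set δ := ‖F' a' y₀ - c‖ - shrinkingSphereRadius n T a' with hδ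
    have hδpos : 0 < δ := by rw [hδ]; linarith [hout y₀]
    have hinit : ∀ y', shrinkingSphereRadius n T a' + δ ≤ ‖F' a' y' - c‖ := fun y' ↦ by
      rw [hδ]; linarith [hmin y']
    have key := hF'.shrinkingSphereRadius_add_le_norm_sub hn c hδpos hinit ht htT y
    have hx : ‖F' t y - c‖ ≤ shrinkingSphereRadius n T t := mem_closedBall_iff_norm.1 hx₂.2
    linarith

/-- **The shrinking ball lies in the level set flow of the ball**: for `n ≥ 1`, `0 ≤ t` and
`2nt ≤ r₀²`, `B̄(c, √(r₀² - 2nt)) ⊆ F_t(B̄(c, r₀))` (maximality of the level set flow applied to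
the weak set flow `isWeakSetFlowIn_shrinkingBall` with `T = r₀²/(2n)`).
[cite: EvansSpruck1991, §7.1 (7.2)–(7.3)] [cite: White2000, §2] -/
theorem closedBall_subset_levelSetFlow_closedBall (hn : 1 ≤ n) (c : EuclideanSpace ℝ (Fin (n + 1)))
    {r₀ : ℝ} (hr₀ : 0 ≤ r₀) {t : ℝ} (ht0 : 0 ≤ t) (ht : 2 * n * t ≤ r₀ ^ 2) :
    closedBall c (Real.sqrt (r₀ ^ 2 - 2 * n * t)) ⊆
      levelSetFlow (euclideanMetric (EuclideanSpace ℝ (Fin (n + 1)))) (closedBall c r₀) t := by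
  have hn0 : (0 : ℝ) < n := by exact_mod_cast hn
  set T : ℝ := r₀ ^ 2 / (2 * n) with hT
  have htT : t ≤ T := by rw [hT, le_div_iff₀ (by positivity)]; linarith
  have hK := isWeakSetFlowIn_shrinkingBall hn c T
  have h0 : {x : EuclideanSpace ℝ (Fin (n + 1)) |
      (0 : ℝ) ≤ T ∧ x ∈ closedBall c (shrinkingSphereRadius n T 0)} ⊆ closedBall c r₀ := by
    intro x hx
    have h := hx.2
    rwa [hT, shrinkingSphereRadius_eq_sqrt hn, mul_zero, sub_zero, Real.sqrt_sq hr₀] at h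
  have h1 : closedBall c (Real.sqrt (r₀ ^ 2 - 2 * n * t)) ⊆
      {x | t ≤ T ∧ x ∈ closedBall c (shrinkingSphereRadius n T t)} := fun x hx ↦
    ⟨htT, by rwa [hT, shrinkingSphereRadius_eq_sqrt hn]⟩
  exact h1.trans (subset_levelSetFlow hK h0 ht0)

/-- Conversely **the level set flow of the ball lies in the shrinking ball** (outer sphere
barriers: `levelSetFlow_subset_ball` of `LevelSetFlowExtinction.lean` for every bigger ball
`B(c, r)`, `r > r₀`). [cite: EvansSpruck1991, §7.1 and Thm. 7.1 (a)] -/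
theorem levelSetFlow_closedBall_subset (hn : 1 ≤ n) (c : EuclideanSpace ℝ (Fin (n + 1)))
    {r₀ : ℝ} (hr₀ : 0 ≤ r₀) {t : ℝ} (ht : 2 * n * t ≤ r₀ ^ 2) :
    levelSetFlow (euclideanMetric (EuclideanSpace ℝ (Fin (n + 1)))) (closedBall c r₀) t ⊆
      closedBall c (Real.sqrt (r₀ ^ 2 - 2 * n * t)) := by
  intro x hx
  rw [mem_closedBall_iff_norm]
  by_contra hlt
  rw [not_le] at hlt
  have ht0 : 0 ≤ t := hx.1
  have hn0 : (0 : ℝ) ≤ n := Nat.cast_nonneg n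
  set d := ‖x - c‖ with hd
  have hdpos : 0 < d := (Real.sqrt_nonneg _).trans_lt hlt
  have hρ : r₀ ^ 2 - 2 * n * t < d ^ 2 := (Real.sqrt_lt' hdpos).1 hlt
  -- a bigger ball `B(c, r)`, `r = √(d² + 2nt) > r₀`, whose flow excludes `x` at time `t`
  set r := Real.sqrt (d ^ 2 + 2 * n * t) with hr
  have hrsq : r ^ 2 = d ^ 2 + 2 * n * t := by
    rw [hr, Real.sq_sqrt (by positivity)]
  have hr₀r : r₀ < r := by
    rw [hr, ← Real.sqrt_sq hr₀]
    exact Real.sqrt_lt_sqrt (sq_nonneg _) (by linarith)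
  have hsub : closedBall c r₀ ⊆ ball c r := closedBall_subset_ball hr₀r
  have h := levelSetFlow_subset_ball hn hsub (t := t) (by rw [hrsq]; nlinarith) hx
  rw [mem_ball, dist_eq_norm, hrsq, add_sub_cancel_right, Real.sqrt_sq hdpos.le] at h
  exact lt_irrefl _ h

/-- **The level set flow of a round ball is the shrinking ball**: for `n ≥ 1`, `r₀ ≥ 0`,
`0 ≤ t` and `2nt ≤ r₀²`,

  `F_t(B̄(c, r₀)) = B̄(c, √(r₀² - 2nt))`

(in particular `F_T = {c}` at `T = r₀²/(2n)`), for the tree's level set flow `levelSetFlow`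
(Hershkovits–White's biggest weak set flow). Evans–Spruck 1991, §7.1, (7.2)–(7.3) (stated there for
the sphere `∂B(0, R)`: `Γ_t = ∂B(0, R(t))`, `{0}` at `t*`, `∅` after, `R(t) = √(R² - 2(n-1)t)` for
hypersurfaces of `ℝⁿ`). [cite: EvansSpruck1991, §7.1 (7.2)–(7.3)] -/
theorem levelSetFlow_closedBall (hn : 1 ≤ n) (c : EuclideanSpace ℝ (Fin (n + 1))) {r₀ : ℝ}
    (hr₀ : 0 ≤ r₀) {t : ℝ} (ht0 : 0 ≤ t) (ht : 2 * n * t ≤ r₀ ^ 2) :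
    levelSetFlow (euclideanMetric (EuclideanSpace ℝ (Fin (n + 1)))) (closedBall c r₀) t =
      closedBall c (Real.sqrt (r₀ ^ 2 - 2 * n * t)) :=
  Subset.antisymm (levelSetFlow_closedBall_subset hn c hr₀ ht)
    (closedBall_subset_levelSetFlow_closedBall hn c hr₀ ht0 ht)

/-- **Past the extinction time the level set flow of the ball is empty**: `F_t(B̄(c, r₀)) = ∅` for
`2nt > r₀²` (a slightly bigger open ball already goes extinct before `t`,
`levelSetFlow_eq_empty_of_lt`). [cite: EvansSpruck1991, §7.1 and Thm. 7.1 (a)] -/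
theorem levelSetFlow_closedBall_eq_empty (hn : 1 ≤ n) (c : EuclideanSpace ℝ (Fin (n + 1)))
    {r₀ : ℝ} (hr₀ : 0 ≤ r₀) {t : ℝ} (ht : r₀ ^ 2 < 2 * n * t) :
    levelSetFlow (euclideanMetric (EuclideanSpace ℝ (Fin (n + 1)))) (closedBall c r₀) t = ∅ := by
  obtain ⟨m, hr₀m, hmt⟩ := exists_between ht
  have hm0 : 0 ≤ m := (sq_nonneg r₀).trans hr₀m.le
  have hsub : closedBall c r₀ ⊆ ball c (Real.sqrt m) := by
    refine closedBall_subset_ball ?_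
    calc r₀ = Real.sqrt (r₀ ^ 2) := (Real.sqrt_sq hr₀).symm
      _ < Real.sqrt m := Real.sqrt_lt_sqrt (sq_nonneg _) hr₀m
  exact levelSetFlow_eq_empty_of_lt hn hsub (t := t) (by rwa [Real.sq_sqrt hm0])

/-- Membership in the level set flow of the ball: `x ∈ F_t(B̄(c, r₀))` iff
`0 ≤ t` and `‖x - c‖² + 2nt ≤ r₀²`. [cite: EvansSpruck1991, §7.1 (7.2)–(7.3)] -/
theorem mem_levelSetFlow_closedBall_iff (hn : 1 ≤ n) (c : EuclideanSpace ℝ (Fin (n + 1)))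
    {r₀ : ℝ} (hr₀ : 0 ≤ r₀) {t : ℝ} {x : EuclideanSpace ℝ (Fin (n + 1))} :
    x ∈ levelSetFlow (euclideanMetric (EuclideanSpace ℝ (Fin (n + 1)))) (closedBall c r₀) t ↔
      0 ≤ t ∧ ‖x - c‖ ^ 2 + 2 * n * t ≤ r₀ ^ 2 := by
  have hn0 : (0 : ℝ) ≤ n := Nat.cast_nonneg n
  constructor
  · intro hx
    have ht0 : 0 ≤ t := hx.1
    rcases le_or_gt (2 * n * t) (r₀ ^ 2) with ht | ht
    · rw [levelSetFlow_closedBall hn c hr₀ ht0 ht, mem_closedBall_iff_norm] at hx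
      refine ⟨ht0, ?_⟩
      have h := pow_le_pow_left₀ (norm_nonneg _) hx 2
      rw [Real.sq_sqrt (by linarith)] at h
      linarith
    · rw [levelSetFlow_closedBall_eq_empty hn c hr₀ ht] at hx
      exact absurd hx (notMem_empty x)
  · rintro ⟨ht0, h⟩
    have ht : 2 * n * t ≤ r₀ ^ 2 := by nlinarith [sq_nonneg ‖x - c‖]
    rw [levelSetFlow_closedBall hn c hr₀ ht0 ht, mem_closedBall_iff_norm]
    rw [← Real.sqrt_sq (norm_nonneg (x - c))]
    exact Real.sqrt_le_sqrt (by linarith)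

/-- **The arrival time of the ball is `u(x) = (r₀² - ‖x - c‖²)/(2n)`** on `B̄(c, r₀)` — the
explicit solution of the level-set / arrival-time equation for the round ball (its level sets are
the spheres `∂B(c, ρ)`, reached at time `(r₀² - ρ²)/(2n)`), for the tree's `arrivalTime`
(`= sup {t : x ∈ F_t}` in `ℝ≥0∞`). [cite: EvansSpruck1991, §7.1 (7.2)–(7.3)]
[cite: ColdingMinicozzi2016, §1] -/
theorem arrivalTime_closedBall (hn : 1 ≤ n) (c : EuclideanSpace ℝ (Fin (n + 1))) {r₀ : ℝ}
    (hr₀ : 0 ≤ r₀) {x : EuclideanSpace ℝ (Fin (n + 1))} (hx : x ∈ closedBall c r₀) :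
    arrivalTime (euclideanMetric (EuclideanSpace ℝ (Fin (n + 1)))) (closedBall c r₀) x =
      ENNReal.ofReal ((r₀ ^ 2 - ‖x - c‖ ^ 2) / (2 * n)) := by
  have hn0 : (0 : ℝ) < n := by exact_mod_cast hn
  set d := ‖x - c‖ with hd
  have hdr : d ≤ r₀ := mem_closedBall_iff_norm.1 hx
  have hd0 : 0 ≤ d := norm_nonneg _
  set tx : ℝ := (r₀ ^ 2 - d ^ 2) / (2 * n) with htx
  have htx' : 2 * n * tx = r₀ ^ 2 - d ^ 2 := by rw [htx]; field_simp
  have htx0 : 0 ≤ tx := by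
    rw [htx]; exact div_nonneg (by nlinarith) (by positivity)
  refine le_antisymm (arrivalTime_le fun t ht ↦ ENNReal.ofReal_le_ofReal ?_) (le_arrivalTime ?_)
  · obtain ⟨ht0, h⟩ := (mem_levelSetFlow_closedBall_iff hn c hr₀).1 ht
    rw [htx, le_div_iff₀ (by positivity)]
    linarith
  · rw [mem_levelSetFlow_closedBall_iff hn c hr₀]
    exact ⟨htx0, by linarith⟩

/-- **The extinction time of the round ball `B̄(c, r₀)` is Huisken's `T = r₀²/(2n)`**
(`extinctionTime = sup_{x ∈ K₀} u(x)`, attained at the centre). [cite: Huisken1984, §1]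
[cite: EvansSpruck1991, §7.1 (7.2)–(7.3)] -/
theorem extinctionTime_closedBall (hn : 1 ≤ n) (c : EuclideanSpace ℝ (Fin (n + 1))) {r₀ : ℝ}
    (hr₀ : 0 ≤ r₀) :
    extinctionTime (euclideanMetric (EuclideanSpace ℝ (Fin (n + 1)))) (closedBall c r₀) =
      ENNReal.ofReal (r₀ ^ 2 / (2 * n)) := by
  have hn0 : (0 : ℝ) < n := by exact_mod_cast hn
  refine le_antisymm (iSup₂_le fun x hx ↦ ?_) ?_
  · rw [arrivalTime_closedBall hn c hr₀ hx]
    exact ENNReal.ofReal_le_ofReal (div_le_div_of_nonneg_right (by nlinarith [sq_nonneg ‖x - c‖])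
      (by positivity))
  · have hc : c ∈ closedBall c r₀ := mem_closedBall_self hr₀
    have h := arrivalTime_le_extinctionTime
      (g := euclideanMetric (EuclideanSpace ℝ (Fin (n + 1)))) hc
    rw [arrivalTime_closedBall hn c hr₀ hc, sub_self, norm_zero] at h
    simpa using h

end Ball

/-! ### Classical flows inside the shrinking ball: lifespan bound -/

section Lifespan

variable {N : Type} [TopologicalSpace N] [ChartedSpace (EuclideanSpace ℝ (Fin n)) N]
  [IsManifold (𝓡 n) ∞ N] {F : ℝ → N → EuclideanSpace ℝ (Fin (n + 1))}
  {ν : (t : ℝ) → NormalField (𝓡 (n + 1)) (F t)} {a b : ℝ}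

/-- **Enclosure by the shrinking ball**: if the initial slice of a classical mean curvature flow on
`[a, b]` lies in `B̄(c, r₀)` then `F_t(N) ⊆ F_{t-a}(B̄(c, r₀))` (the level set flow of the ball) for
all `t ∈ [a, b]` — classical flows are weak set flows inside the biggest flow
(`IsClassicalMCF.range_subset_levelSetFlow`, after the time shift `IsClassicalMCF.comp_add`).
[cite: White2000, §2] [cite: EvansSpruck1991, §7.1] -/
theorem IsClassicalMCF.range_subset_levelSetFlow_closedBall
    (h : IsClassicalMCF (euclideanMetric (EuclideanSpace ℝ (Fin (n + 1)))) F ν a b)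
    {c : EuclideanSpace ℝ (Fin (n + 1))} {r₀ : ℝ} (h₀ : range (F a) ⊆ closedBall c r₀) {t : ℝ}
    (ht : t ∈ Icc a b) :
    range (F t) ⊆ levelSetFlow (euclideanMetric (EuclideanSpace ℝ (Fin (n + 1)))) (closedBall c r₀) (t - a) := by
  have h' := h.comp_add a
  rw [sub_self] at h'
  have h₀' : range ((fun r ↦ F (r + a)) 0) ⊆ closedBall c r₀ := by
    simpa using h₀
  have hsub := h'.range_subset_levelSetFlow h₀' (t := t - a) ⟨by linarith [ht.1], by linarith [ht.2]⟩
  simpa using hsub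

/-- **Comparison with the shrinking sphere, quantitative**: if the initial slice lies in
`B̄(c, r₀)` then `2n(t - a) ≤ r₀²` for every time `t ∈ [a, b]` of existence of the (nonempty)
classical flow — the level set flow of the ball is empty after time `r₀²/2n`
(`levelSetFlow_closedBall_eq_empty`) but contains the nonempty slice `F_t(N)`.
[cite: EvansSpruck1991, §7.1] [cite: Mantegazza2011, Cor. 2.2.5] -/
theorem IsClassicalMCF.two_mul_mul_sub_le_sq_of_mem (hn : 1 ≤ n) [Nonempty N]
    (h : IsClassicalMCF (euclideanMetric (EuclideanSpace ℝ (Fin (n + 1)))) F ν a b)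
    {c : EuclideanSpace ℝ (Fin (n + 1))} {r₀ : ℝ} (hr₀ : 0 ≤ r₀) (h₀ : range (F a) ⊆ closedBall c r₀)
    {t : ℝ} (ht : t ∈ Icc a b) :
    2 * n * (t - a) ≤ r₀ ^ 2 := by
  by_contra hlt
  rw [not_le] at hlt
  have hsub := h.range_subset_levelSetFlow_closedBall h₀ ht
  rw [levelSetFlow_closedBall_eq_empty hn c hr₀ hlt, subset_empty_iff, range_eq_empty_iff] at hsub
  exact not_isEmpty_of_nonempty N hsub

/-- **Lifespan bound by comparison with the shrinking sphere**: a classical mean curvature flow of a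
nonempty compact hypersurface in `ℝⁿ⁺¹` (`n ≥ 1`) on `[a, b]` whose initial slice lies in
`B̄(c, r₀)` satisfies `2n(b - a) ≤ r₀²` — it cannot outlive the ball `B̄(c, r₀)`, which
disappears at time `r₀²/2n` (Huisken 1984; Evans–Spruck 1991, §7.1).
[cite: EvansSpruck1991, §7.1] [cite: Mantegazza2011, Cor. 2.2.5] -/
theorem IsClassicalMCF.two_mul_mul_sub_le_sq (hn : 1 ≤ n) [Nonempty N]
    (h : IsClassicalMCF (euclideanMetric (EuclideanSpace ℝ (Fin (n + 1)))) F ν a b) (hab : a ≤ b)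
    {c : EuclideanSpace ℝ (Fin (n + 1))} {r₀ : ℝ} (hr₀ : 0 ≤ r₀) (h₀ : range (F a) ⊆ closedBall c r₀) :
    2 * n * (b - a) ≤ r₀ ^ 2 :=
  h.two_mul_mul_sub_le_sq_of_mem hn hr₀ h₀ ⟨hab, le_rfl⟩

/-- **The slices stay in the shrinking balls**: `F_t(N) ⊆ B̄(c, √(r₀² - 2n(t - a)))` for
`t ∈ [a, b]` (`levelSetFlow_closedBall`; the radicand is nonnegative by the previous bound).
[cite: EvansSpruck1991, §7.1] [cite: Mantegazza2011, Cor. 2.2.5] -/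
theorem IsClassicalMCF.range_subset_closedBall_sqrt (hn : 1 ≤ n) [Nonempty N]
    (h : IsClassicalMCF (euclideanMetric (EuclideanSpace ℝ (Fin (n + 1)))) F ν a b)
    {c : EuclideanSpace ℝ (Fin (n + 1))} {r₀ : ℝ} (hr₀ : 0 ≤ r₀) (h₀ : range (F a) ⊆ closedBall c r₀)
    {t : ℝ} (ht : t ∈ Icc a b) :
    range (F t) ⊆ closedBall c (Real.sqrt (r₀ ^ 2 - 2 * n * (t - a))) := by
  have hsub := h.range_subset_levelSetFlow_closedBall h₀ ht
  rwa [levelSetFlow_closedBall hn c hr₀ (sub_nonneg.2 ht.1)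
    (h.two_mul_mul_sub_le_sq_of_mem hn hr₀ h₀ ht)] at hsub

end Lifespan

end Literature.Geometry.Riemannian

end
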